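import Literature.NumberTheory.Rogawski1990.CharIdentityOnTestFunctionsSigned
import HarnessLib

/-!
# The SIGNED character identity [Rogawski1990, 13.1.4] on test functions — accessors, constructor, read-backs, `ε = 1` bridges

Topic `NumberTheory/Rogawski1990`; namespace `Literature.NumberTheory.Rogawski1990`.  One CHOICE definition (`CMNonsplitCharIdentityAtTestSigned.πs := h.choose`, the
signed twin of ★ `CMNonsplitCharIdentityAtTest.πs`) + THEOREMS over the sibling statement module ★ `CharIdentityOnTestFunctionsSigned` (A-p16 (g27), ★ p842701);
no named fact, no instance, no notation, no `sorry`; the statement modules are NOT edited.  Cell `pub/hodgecm-mathlib` (D-0151), crux H413 `stmt-HodgeConjecture-24833`;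
desk F0P3b-plan (g12) DEAL 2026-09-01T09:18:05Z brick **(QS-ACC)** for the closer edition «QCMT SIGNED» (successor desk F0P3-plan (g9)) and the signed bridge twin
`Theorems/F0P3XiEvpOfRecordSCDSigned` (brick (QS-SCD)); seat F0P3b-p01 (g7).  HONEST LABEL: HC_CM is proved only modulo the 2 remaining named inputs (hLiu418, h413)
until rung 0 closes.

* §1 READ-OFF of the signed non-split letter `h : CMNonsplitCharIdentityAtTestSigned L v H′ T mH mG μG μH ξv ε πⁿ`: `h.πs` (the supercuspidal partner, a choice),
  `h.πs_isSupercuspidal`, `h.πs_ne`, `h.charIdentityAtTestSigned_πs` (the packet `{πⁿ, h.πs}` satisfies [13.1.4] on test functions with member traces `ε · Tr`),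
  `h.charDist_eq_mul_add` (explicit sum `∫ ξ_v f^H dμ_H = ε · (Tr πⁿ(f) + Tr h.πs(f))` on `Δ`-matched test pairs), and the constructor
  `cmNonsplitCharIdentityAtTestSigned_of_charIdentityAtTest`.
* §2 `ε = 1`: `CMNonsplitCharIdentityAtTest.signed_one` ∕ `CMNonsplitCharIdentityAtTestSigned.unsigned_of_one` (★ `cmNonsplitCharIdentityAtTestSigned_one_iff`) and
  `CMNonsplitCharIdentityAtTestSigned.πs_one_spec` (at `ε = 1` the signed choice satisfies the UNSIGNED identity).
-/

set_option autoImplicit false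

noncomputable section

open MeasureTheory NumberField IsDedekindDomain Topology
open scoped Matrix MatrixGroups ComplexOrder

namespace Literature.NumberTheory.Rogawski1990

open Literature.NumberTheory.Automorphic Literature.NumberTheory.Automorphic.UnitaryGroup
open Literature.NumberTheory.Automorphic.UnitaryGroup.CotangentForms Literature.NumberTheory.GaloisRepresentations
open Literature.NumberTheory.Automorphic.Arthur2013.Leaves.TECR

/-! ## §1 Read-off of the signed non-split letter -/

section ReadOffSigned

variable {L : Type} [Field L] [NumberField L] [IsCMField L] {v : HeightOneSpectrum (𝓞 ↥(maximalRealSubfield L))}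
  {H' : Matrix (Fin 3) (Fin 3) L}

variable
    [MeasurableSpace ((UnitaryGroup.cmDatum L 3 H').Local v)]
    [MeasurableSpace ((UnitaryGroup.cmDatum L 2 (Matrix.of fun i j : Fin 2 => if i.val + j.val + 1 = 2 then (1 : L) else 0)).Local v ×
      (UnitaryGroup.cmDatum L 1 (Matrix.of fun i j : Fin 1 => if i.val + j.val + 1 = 1 then (1 : L) else 0)).Local v)]
    [∀ a : ((UnitaryGroup.cmDatum L 2 (Matrix.of fun i j : Fin 2 => if i.val + j.val + 1 = 2 then (1 : L) else 0)).Local v ×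
        (UnitaryGroup.cmDatum L 1 (Matrix.of fun i j : Fin 1 => if i.val + j.val + 1 = 1 then (1 : L) else 0)).Local v),
      MeasurableSpace (((UnitaryGroup.cmDatum L 2 (Matrix.of fun i j : Fin 2 => if i.val + j.val + 1 = 2 then (1 : L) else 0)).Local v ×
        (UnitaryGroup.cmDatum L 1 (Matrix.of fun i j : Fin 1 => if i.val + j.val + 1 = 1 then (1 : L) else 0)).Local v) ⧸
        Subgroup.centralizer ({a} : Set ((UnitaryGroup.cmDatum L 2 (Matrix.of fun i j : Fin 2 => if i.val + j.val + 1 = 2 then (1 : L) else 0)).Local v ×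
        (UnitaryGroup.cmDatum L 1 (Matrix.of fun i j : Fin 1 => if i.val + j.val + 1 = 1 then (1 : L) else 0)).Local v)))]
    [∀ γ : (UnitaryGroup.cmDatum L 3 H').Local v,
      MeasurableSpace ((UnitaryGroup.cmDatum L 3 H').Local v ⧸ Subgroup.centralizer ({γ} : Set ((UnitaryGroup.cmDatum L 3 H').Local v)))]
    {T : LocalTransferFactor L H' v}
    {mH : OrbitalMeasureFamily ((UnitaryGroup.cmDatum L 2 (Matrix.of fun i j : Fin 2 => if i.val + j.val + 1 = 2 then (1 : L) else 0)).Local v ×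
        (UnitaryGroup.cmDatum L 1 (Matrix.of fun i j : Fin 1 => if i.val + j.val + 1 = 1 then (1 : L) else 0)).Local v)}
    {mG : OrbitalMeasureFamily ((UnitaryGroup.cmDatum L 3 H').Local v)} {μG : Measure ((UnitaryGroup.cmDatum L 3 H').Local v)}
    {μH : Measure ((UnitaryGroup.cmDatum L 2 (Matrix.of fun i j : Fin 2 => if i.val + j.val + 1 = 2 then (1 : L) else 0)).Local v ×
        (UnitaryGroup.cmDatum L 1 (Matrix.of fun i j : Fin 1 => if i.val + j.val + 1 = 1 then (1 : L) else 0)).Local v)}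
    {ξv : (UnitaryGroup.cmDatum L 2 (Matrix.of fun i j : Fin 2 => if i.val + j.val + 1 = 2 then (1 : L) else 0)).Local v ×
        (UnitaryGroup.cmDatum L 1 (Matrix.of fun i j : Fin 1 => if i.val + j.val + 1 = 1 then (1 : L) else 0)).Local v →* ℂˣ}
    {ε : ℂ} {πn : IrrClass ((UnitaryGroup.cmDatum L 3 H').Local v)}

/-- **`πˢ(ξ_v)` read off the SIGNED letter [13.1.4] on test functions** (a CHOICE of the existential; signed twin of ★ `CMNonsplitCharIdentityAtTest.πs`).
[cite: Rogawski1990, §13.1 Prop. 13.1.3 (d), Prop. 13.1.4 p. 199] -/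
def CMNonsplitCharIdentityAtTestSigned.πs (h : CMNonsplitCharIdentityAtTestSigned L v H' T mH mG μG μH ξv ε πn) :
    IrrClass ((UnitaryGroup.cmDatum L 3 H').Local v) :=
  Exists.choose h

/-- `h.πs` is supercuspidal [13.1.3 (d)]. [cite: Rogawski1990, §13.1 Prop. 13.1.3 (d) p. 199] -/
theorem CMNonsplitCharIdentityAtTestSigned.πs_isSupercuspidal (h : CMNonsplitCharIdentityAtTestSigned L v H' T mH mG μG μH ξv ε πn) :
    h.πs.IsSupercuspidal :=
  (Exists.choose_spec h).1

/-- `h.πs ≠ πⁿ`. [cite: Rogawski1990, §13.1 Prop. 13.1.3 (d) p. 199] -/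
theorem CMNonsplitCharIdentityAtTestSigned.πs_ne (h : CMNonsplitCharIdentityAtTestSigned L v H' T mH mG μG μH ξv ε πn) : h.πs ≠ πn :=
  (Exists.choose_spec h).2.1

/-- **The packet `{πⁿ, h.πs}` satisfies the SIGNED [13.1.4] on test functions** on the given data (member traces `ε · Tr π(f dμ_G)`).
[cite: Rogawski1990, §13.1 Prop. 13.1.4 p. 199; §14.6 p. 242] -/
theorem CMNonsplitCharIdentityAtTestSigned.charIdentityAtTestSigned_πs (h : CMNonsplitCharIdentityAtTestSigned L v H' T mH mG μG μH ξv ε πn) :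
    (⟨πn, some h.πs⟩ : CMLocalAPacket L H' v).CharIdentityAtTest L H' v (fun c f => ε * c.smoothTrace μG f) ξv μH T mH mG :=
  (Exists.choose_spec h).2.2

/-- **Explicit sum**: `∫ ξ_v f^H dμ_H = ε · (Tr πⁿ(f dμ_G) + Tr h.πs(f dμ_G))` for every `Δ_v`-matching pair of TEST functions (★ `charIdentityAtTest_pair_iff`, `mul_add`).
[cite: Rogawski1990, §13.1 Prop. 13.1.4 p. 199; §12.3 Prop. 12.3.3 (a) p. 178] -/
theorem CMNonsplitCharIdentityAtTestSigned.charDist_eq_mul_add (h : CMNonsplitCharIdentityAtTestSigned L v H' T mH mG μG μH ξv ε πn)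
    (fH : (UnitaryGroup.cmDatum L 2 (Matrix.of fun i j : Fin 2 => if i.val + j.val + 1 = 2 then (1 : L) else 0)).Local v ×
        (UnitaryGroup.cmDatum L 1 (Matrix.of fun i j : Fin 1 => if i.val + j.val + 1 = 1 then (1 : L) else 0)).Local v → ℂ)
    (f : (UnitaryGroup.cmDatum L 3 H').Local v → ℂ) (hfH : IsLocSmooth fH) (hf : IsLocSmooth f) (hΔ : IsLocalDeltaTransfer L H' v T mH mG fH f) :
    charDist ξv μH fH = ε * (πn.smoothTrace μG f + h.πs.smoothTrace μG f) := by
  rw [mul_add]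
  exact (LocalAPacket.charIdentityAtTest_pair_iff L H' (v := v) πn h.πs (fun c f => ε * c.smoothTrace μG f) ξv μH T mH mG).1 h.charIdentityAtTestSigned_πs
    fH f hfH hf hΔ

/-- Constructor: a packet `⟨πⁿ, some πˢ⟩` with `πˢ` supercuspidal `≠ πⁿ` satisfying the SIGNED [13.1.4] on test functions gives `CMNonsplitCharIdentityAtTestSigned … ε πⁿ`.
[cite: Rogawski1990, §13.1 Prop. 13.1.3 (d), Prop. 13.1.4 p. 199] -/
theorem cmNonsplitCharIdentityAtTestSigned_of_charIdentityAtTest (πs : IrrClass ((UnitaryGroup.cmDatum L 3 H').Local v)) (hsc : πs.IsSupercuspidal)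
    (hne : πs ≠ πn) (h : (⟨πn, some πs⟩ : CMLocalAPacket L H' v).CharIdentityAtTest L H' v (fun c f => ε * c.smoothTrace μG f) ξv μH T mH mG) :
    CMNonsplitCharIdentityAtTestSigned L v H' T mH mG μG μH ξv ε πn :=
  ⟨πs, hsc, hne, h⟩

/-! ## §2 `ε = 1` bridges -/

/-- From the UNSIGNED letter to the signed one at `ε = 1` (★ `cmNonsplitCharIdentityAtTestSigned_one_iff`). [cite: Rogawski1990, §13.1 Prop. 13.1.4 p. 199] -/
theorem CMNonsplitCharIdentityAtTest.signed_one (h : CMNonsplitCharIdentityAtTest L v H' T mH mG μG μH ξv πn) :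
    CMNonsplitCharIdentityAtTestSigned L v H' T mH mG μG μH ξv 1 πn :=
  (cmNonsplitCharIdentityAtTestSigned_one_iff L v H' T mH mG μG μH ξv πn).2 h

/-- From the signed letter at `ε = 1` to the UNSIGNED one (★ `cmNonsplitCharIdentityAtTestSigned_one_iff`). [cite: Rogawski1990, §13.1 Prop. 13.1.4 p. 199] -/
theorem CMNonsplitCharIdentityAtTestSigned.unsigned_of_one (h : CMNonsplitCharIdentityAtTestSigned L v H' T mH mG μG μH ξv 1 πn) :
    CMNonsplitCharIdentityAtTest L v H' T mH mG μG μH ξv πn :=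
  (cmNonsplitCharIdentityAtTestSigned_one_iff L v H' T mH mG μG μH ξv πn).1 h

/-- At `ε = 1` the signed choice `h.πs` satisfies the UNSIGNED [13.1.4] on test functions (`one_mul`). [cite: Rogawski1990, §13.1 Prop. 13.1.4 p. 199] -/
theorem CMNonsplitCharIdentityAtTestSigned.πs_one_spec (h : CMNonsplitCharIdentityAtTestSigned L v H' T mH mG μG μH ξv 1 πn) :
    (⟨πn, some h.πs⟩ : CMLocalAPacket L H' v).CharIdentityAtTest L H' v (fun c f => c.smoothTrace μG f) ξv μH T mH mG := by
  have h' := h.charIdentityAtTestSigned_πs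
  simp only [one_mul] at h'
  exact h'

end ReadOffSigned

end Literature.NumberTheory.Rogawski1990

end
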